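import Summits.MatrixMultiplication.OmegaCensus.STPP211Z2pow6DirectChunks

/-!
# (2,1,1)¹⁰ ⊄ (ℤ/2)⁶ — part S2 class 08, decisions 4/4: direct search over the hard class #22 of `reps29` (roots d = 41)

Cell `pub-omega` (unit `pub-omega-stpp-1-g37`), topic `Summits/MatrixMultiplication/OmegaCensus`.
HONEST FRAMING (verbatim): lottery ticket; floor = certified bounds/negative ranges. Census STRUCTURE bookkeeping (B5, `T1((ℤ/2)⁶)`, Pb237);
nothing here is a bound on `ω`.

Class #22 of `reps29` in the translated form `C' = hc08 = [0, 7, 19, 21, 22, 23, 24, 31, 47, 55]` (`+ 23`, block of `c = 23` first; linear stabilizer of order 48,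
root representatives [1, 8, 11, 16, 25, 32, 35, 40, 41]; HOME `pub-omega-stpp-1-g36/code/hard_perd.json`). The kernel evaluates the direct engine
(`STPP211Z2pow6DirectEngine.rootD`, soundness `noNF_of_rootD`) in CHUNKS of the root node (`STPP211Z2pow6DirectChunks.rootDX`, ≤ 10⁵ search
calls each, exact counts from the seat's C mirror `godc.c`; this file: 89,643 calls) and assembles `rootD C' d = true` per root by
`rootD_of_chunks`. The class theorem follows in `STPP211Z2pow6Hard08Class` (symmetry transport, `STPP211Z2pow6DirectTransport`).

References: H. Cohn, R. Kleinberg, B. Szegedy, C. Umans, FOCS 2005 (arXiv:math/0511460), Def. 5.1.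
-/

namespace Summit.MatrixMultiplication.OmegaCensus

namespace T1CosetEng

/-- KERNEL: root `d = 41`, chunk 1 (codes `x = 0 … 63` of the branching label's lane; 89,642 search calls). -/
theorem hc08_d41_c1 : rootDX [0, 7, 19, 21, 22, 23, 24, 31, 47, 55] 41 18446744073709551615 = true := by decide +kernel

/-- KERNEL (assembled): the direct search from the root `A₀ = {0, dec 41}` refutes every normal-form family over `C'`. -/
theorem hc08_d41 : rootD [0, 7, 19, 21, 22, 23, 24, 31, 47, 55] 41 = true :=
  rootD_of_chunks [0, 7, 19, 21, 22, 23, 24, 31, 47, 55] 41 [18446744073709551615] (by decide) (cover_of_all64 _ (by decide)) (by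
    intro M hM
    simp only [List.mem_cons, List.not_mem_nil, or_false] at hM
    rcases hM with rfl
    exacts [hc08_d41_c1])

end T1CosetEng

end Summit.MatrixMultiplication.OmegaCensus
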